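import Summits.QuantumFields.BalabanUV.Beta.GAN24.DressedStepFaceChargesWeighted
import Summits.QuantumFields.BalabanUV.Beta.GAN24.BiStencilZeroMode

/-!
# `BalabanUV.Beta.GAN24.FourFaceSourceWords` — binder row G-an2-4 ∕ (CONV-C), conservation law (C) AT LEVELS `j ≥ 1`, CONTACT side, the (γ) hand's «DEPTH TOWER»
# (memo `HOME/b2b-balaban-gan24-formalise-leaf-06/g54/C-LEVELS-GE1-g54.md` §29–§32, letter K6c): **THE FOUR-FACE READING OF THE DRESSED ONE-STEP SOURCE IS A
# FACE-RESTRICTED CELL-AND-LATTICE SUM OF leaf-04's THREE TWO-FACE WORDS WITH THE DEEP LEG CLASS `[y_α % Lc² = Lc² − 1]`** — the FF twin of leaf-04's 21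
# `DressedSourceZeroModeWords.zmode_dressedSource_inl_inl`: road-P2's four-face literal (`T2RecChargeStepFourFace.zmode_succ_eq_fourFace`: bonds outside, legs
# inside, one conjunctive exit-face mask at period `Lc`) applied to `c • mmRead Lc (K3OfK X̃♮_j Lc S M W) + cB • B` (any localised `S M W`, any border `B` with zero ff
# block) equals `c·(−K_j²)·Σ_{r′ ∈ box Lc, r′_μ exit} Σ'_{u′, u′_ν exit} ( FF²[(dM_μ∘X̃♮_j)∘dM_ν] + FF²[(dM_ν∘X̃♮_j)∘dM_μ] − FF²[W_{μν}] )`,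
# `FF²[V] = Σ'_{(y,w)} [y_α % Lc² = Lc²−1]·[w_β % Lc² = Lc²−1]·V y w (inl α)(inl β)`, `K_j = (s_f s_m)·(stepScale_j·Lc^{d+1})⁻¹` (`fourFace_dressedSource_inl_inl`).

NOT IN PRINT; OUR BOOKKEEPING ([folklore] `tsum` bookkeeping BY NAME over K6b `DressedStepFaceChargesWeighted.hasSum_mmRead_K3OfK_dressedStep_weight` at the weights
`f = g = [· % Lc = Lc − 1]` (field-leg charges `∓[a=α]·[y_α exit]·K_j·[⌊y_α∕Lc⌋ exit]`, multiplier-leg charges `0`) and leaf-04 g62's `FaceWeightedSandwich.emod_mul_eq_iff`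
(`[u % Lc = Lc−1]·[⌊u∕Lc⌋ % Lc = Lc−1] = [u % Lc² = Lc²−1]`); G-an2-4 formalisation swarm, leaf prover `b2b-balaban-gan24-formalise-leaf-06`, gen 54).  HONEST FRAMING (cell
contract, verbatim): «discharging `BetaPertH` makes Bałaban's UV stability UNCONDITIONAL — a real constructive-QFT result; it is NOT the continuum limit and NOT the Clay
problem.»  HONEST DEPENDENCY (verbatim): «continuum YM on T⁴ ⇐ BetaPertH ∧ nine spine estimates (0/9 proved); BetaPertH ⇐ (D1) ∧ (D4) ∧ CAP+tail; G-an2-4 gates asym, D1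
and NE2/3/4.»

WHY: p2's one-step charge law at level `j+1` carries `λ̂·Lc⁴·[FF(T̃_j)(μν;αβ) + FF(T̃_j)(νμ;αβ)]`; for `j ≥ 1` the member `T̃_j` is itself `c • mmRead Lc (K3OfK X̃♮_{j−1} …) +
cB • vh₂S`, and THIS FILE opens `FF` of that source part exactly as leaf-04's 21 opened its zero mode: the SAME three words, the bond sums restricted to exit faces, the leg
masks one class DEEPER.  The sector split (leaf-04's 29∕30 at the deep leg class) and the EE evaluation (this lineage's depth tower K4 → K1a → K1b∕K2 → K5 → K3) come next.

WHAT ([folklore]; in-block root, `1 ≤ Lc`, every `j`, all units, generic localised `S M W`, any border with zero ff block; 0 `def`, 0 cited facts, 0 `def … : Prop`,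
0 sorry): `ite_and_and_eq`, `sum_elim_and_charges`, `deepMask_eq`, `readout_eq_deepFF` (K6b's `R[V]` at the face weights `= −K_j²·FF²[V]`), **`fourFace_dressedSource_inl_inl`**.
Asserts NO value of Bałaban's tables; discharges NOTHING of (C) ∕ (C)sym ∕ (Q-D); NOT the sector split, NOT the evaluation of any word; NEVER «G-an2-4 closed» as (CONV-C);
NOT D1, NOT `BetaPertH`, NOT continuum, NOT Clay.  2026-08-24; no existing file touched.
-/

noncomputable section

open Finset
open scoped BigOperators
open Literature.MathematicalPhysics.QuantumFieldTheory
open Literature.MathematicalPhysics.QuantumFieldTheory.Balaban1983to89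
open Literature.MathematicalPhysics.QuantumFieldTheory.Balaban1983to89.Beta
open ExpKernelCalculus (Site MKer comp)
open OneStepResolventKernel (Fib)
open SecondOrderResponse (dM)
open BalabanStepW2 (K3OfK)
open BalabanStepJetsSucc (mmRead)
open OneStepKernelFamily (KInvStep)
open AffineAveraging (box toSite)
open AveragingContours (blk)
open Summit.QuantumFields.BalabanUV.Beta.TameKernelCalculus (Loc)
open Summit.QuantumFields.BalabanUV.Beta.BorderedHessian (stepScale)
open Summit.QuantumFields.BalabanUV.Beta.AxialDressingRooted (coDressKBmAt)
open Summit.QuantumFields.BalabanUV.Beta.HessKerDressedUnits (unitK)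
open Summit.QuantumFields.BalabanUV.Beta.GAN24.BiStencilZeroMode (Tab)
open Summit.QuantumFields.BalabanUV.Beta.GAN24.FaceWeightedSandwich (emod_mul_eq_iff)
open Summit.QuantumFields.BalabanUV.Beta.GAN24.DressedStepFaceChargesWeighted (hasSum_mmRead_K3OfK_dressedStep_weight)

namespace Summit.QuantumFields.BalabanUV.Beta.GAN24.FourFaceSourceWords

variable {d : ℕ} {Lc : ℕ} [NeZero Lc] {r : Fin (d + 1) → ℕ}

/-! ## §1 Finite bookkeeping: masks and fibre charges -/

omit [NeZero Lc] in
/-- [folklore] A conjunctive two-condition mask is the product of the two indicator weights. -/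
theorem ite_and_and_eq (P Q : Prop) [Decidable P] [Decidable Q] (v : ℝ) :
    (if P ∧ Q then v else 0) = (if P then (1 : ℝ) else 0) * (if Q then (1 : ℝ) else 0) * v := by
  by_cases hP : P <;> by_cases hQ : Q <;> simp [hP, hQ]

omit [NeZero Lc] in
/-- [folklore] **ONLY THE FIELD FIBRES `(inl α, inl β)` CARRY CHARGE**: the double fibre sum against charges supported on `inl α` ∕ `inl β` collapses. -/
theorem sum_elim_and_charges (V : Fib d → Fib d → ℝ) (α β : Fin (d + 1)) (A B : ℝ) (P Q : Prop) [Decidable P] [Decidable Q] :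
    (∑ f : Fib d, ∑ g : Fib d, Sum.elim (fun a => if a = α ∧ P then A else 0) (fun _ => (0 : ℝ)) f * V f g *
        Sum.elim (fun b => if b = β ∧ Q then B else 0) (fun _ => (0 : ℝ)) g) =
      (if P then A else 0) * V (Sum.inl α) (Sum.inl β) * (if Q then B else 0) := by
  classical
  rw [Fintype.sum_sum_type]
  simp only [Sum.elim_inl, Sum.elim_inr, zero_mul, Finset.sum_const_zero, add_zero]
  have hin : ∀ a : Fin (d + 1), (∑ g : Fib d, (if a = α ∧ P then A else 0) * V (Sum.inl a) g *
      Sum.elim (fun b => if b = β ∧ Q then B else 0) (fun _ => (0 : ℝ)) g) =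
      (if a = α ∧ P then A else 0) * V (Sum.inl a) (Sum.inl β) * (if Q then B else 0) := by
    intro a
    rw [Fintype.sum_sum_type]
    simp only [Sum.elim_inl, Sum.elim_inr, mul_zero, Finset.sum_const_zero, add_zero]
    rw [Finset.sum_eq_single β]
    · simp
    · intro b _ hb; simp [hb]
    · intro h; exact absurd (Finset.mem_univ β) h
  simp only [hin]
  rw [Finset.sum_eq_single α]
  · simp
  · intro a _ ha; simp [ha]
  · intro h; exact absurd (Finset.mem_univ α) h

omit [NeZero Lc] in
/-- [folklore] **THE TWO-SCALE EXIT CONDITION AS ONE DEEP MASK** (leaf-04's `emod_mul_eq_iff`): `[u % Lc = Lc−1]·(K·[⌊u∕Lc⌋ % Lc = Lc−1]) = K·[u % Lc² = Lc²−1]`. -/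
theorem deepMask_eq (hLc : 0 < (Lc : ℤ)) (u : ℤ) (K : ℝ) :
    (if u % (Lc : ℤ) = (Lc : ℤ) - 1 then K * (if u / (Lc : ℤ) % (Lc : ℤ) = (Lc : ℤ) - 1 then (1 : ℝ) else 0) else 0) =
      K * (if u % ((Lc : ℤ) * (Lc : ℤ)) = (Lc : ℤ) * (Lc : ℤ) - 1 then (1 : ℝ) else 0) := by
  have h := emod_mul_eq_iff hLc hLc u
  by_cases h1 : u % (Lc : ℤ) = (Lc : ℤ) - 1 <;> by_cases h2 : u / (Lc : ℤ) % (Lc : ℤ) = (Lc : ℤ) - 1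
  · have h3 : u % ((Lc : ℤ) * (Lc : ℤ)) = (Lc : ℤ) * (Lc : ℤ) - 1 := h.2 ⟨h1, h2⟩
    simp [h1, h2, h3]
  · have h3 : ¬ u % ((Lc : ℤ) * (Lc : ℤ)) = (Lc : ℤ) * (Lc : ℤ) - 1 := fun h3 => h2 (h.1 h3).2
    simp [h1, h2, h3]
  · have h3 : ¬ u % ((Lc : ℤ) * (Lc : ℤ)) = (Lc : ℤ) * (Lc : ℤ) - 1 := fun h3 => h1 (h.1 h3).1
    simp [h1, h3]
  · have h3 : ¬ u % ((Lc : ℤ) * (Lc : ℤ)) = (Lc : ℤ) * (Lc : ℤ) - 1 := fun h3 => h1 (h.1 h3).1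
    simp [h1, h3]

/-- [folklore] **K6b's READ-OUT WORD AT THE FACE WEIGHTS IS `−K_j²` TIMES THE DEEP TWO-FACE WORD**: for any two-leg table `V`,
`Σ'_{(y,w)} Σ_{f,g} ρL^χ f y·V y w f g·ρR^χ g w = −K_j²·Σ'_{(y,w)} [y_α % Lc² = Lc²−1]·[w_β % Lc² = Lc²−1]·V y w (inl α)(inl β)`. -/
theorem readout_eq_deepFF (sf sm : ℝ) (j : ℕ) (α β : Fin (d + 1)) (V : MKer (d + 1) (Fib d)) :
    (∑' yw : Site (d + 1) × Site (d + 1), ∑ φ' : Fib d, ∑ γ' : Fib d,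
            Sum.elim (fun a => if a = α ∧ yw.1 α % (Lc : ℤ) = (Lc : ℤ) - 1 then -((sf * sm) * ((stepScale d Lc j * (Lc : ℝ) ^ (d + 1))⁻¹ * (fun s : ℤ => if s % (Lc : ℤ) = (Lc : ℤ) - 1 then (1 : ℝ) else 0) (blk Lc yw.1 α))) else 0)
              (fun _ => (0 : ℝ)) φ' *
            V yw.1 yw.2 φ' γ' *
            Sum.elim (fun b' => if b' = β ∧ yw.2 β % (Lc : ℤ) = (Lc : ℤ) - 1 then (sf * sm) * ((stepScale d Lc j * (Lc : ℝ) ^ (d + 1))⁻¹ * (fun s : ℤ => if s % (Lc : ℤ) = (Lc : ℤ) - 1 then (1 : ℝ) else 0) (blk Lc yw.2 β)) else 0)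
              (fun _ => (0 : ℝ)) γ') =
      -(((sf * sm) * (stepScale d Lc j * (Lc : ℝ) ^ (d + 1))⁻¹) * ((sf * sm) * (stepScale d Lc j * (Lc : ℝ) ^ (d + 1))⁻¹)) * ∑' yw : Site (d + 1) × Site (d + 1),
        (if yw.1 α % ((Lc : ℤ) * (Lc : ℤ)) = (Lc : ℤ) * (Lc : ℤ) - 1 then (1 : ℝ) else 0) * (if yw.2 β % ((Lc : ℤ) * (Lc : ℤ)) = (Lc : ℤ) * (Lc : ℤ) - 1 then (1 : ℝ) else 0) *
          V yw.1 yw.2 (Sum.inl α) (Sum.inl β) := by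
  classical
  have hLc : 0 < (Lc : ℤ) := by exact_mod_cast Nat.pos_of_ne_zero (NeZero.ne Lc)
  rw [← tsum_mul_left]
  refine tsum_congr fun yw => ?_
  rw [sum_elim_and_charges]
  have hL : (if yw.1 α % (Lc : ℤ) = (Lc : ℤ) - 1 then -((sf * sm) * ((stepScale d Lc j * (Lc : ℝ) ^ (d + 1))⁻¹ * (fun s : ℤ => if s % (Lc : ℤ) = (Lc : ℤ) - 1 then (1 : ℝ) else 0) (blk Lc yw.1 α))) else 0) =
      -(((sf * sm) * (stepScale d Lc j * (Lc : ℝ) ^ (d + 1))⁻¹) * (if yw.1 α % ((Lc : ℤ) * (Lc : ℤ)) = (Lc : ℤ) * (Lc : ℤ) - 1 then (1 : ℝ) else 0)) := by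
    rw [← deepMask_eq hLc]
    simp only [blk]
    split_ifs <;> ring
  have hR : (if yw.2 β % (Lc : ℤ) = (Lc : ℤ) - 1 then (sf * sm) * ((stepScale d Lc j * (Lc : ℝ) ^ (d + 1))⁻¹ * (fun s : ℤ => if s % (Lc : ℤ) = (Lc : ℤ) - 1 then (1 : ℝ) else 0) (blk Lc yw.2 β)) else 0) =
      ((sf * sm) * (stepScale d Lc j * (Lc : ℝ) ^ (d + 1))⁻¹) * (if yw.2 β % ((Lc : ℤ) * (Lc : ℤ)) = (Lc : ℤ) * (Lc : ℤ) - 1 then (1 : ℝ) else 0) := by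
    rw [← deepMask_eq hLc]
    simp only [blk]
    split_ifs <;> ring
  rw [hL, hR]
  ring

/-! ## §2 The four-face reading of the dressed one-step source -/

/-- [folklore] **THE FOUR-FACE READING OF THE DRESSED ONE-STEP SOURCE** (road-P2's literal: bonds outside, legs inside, one conjunctive exit-face mask at period `Lc`):
`Σ_{r′∈box Lc} Σ'_{u′} Σ'_x Σ'_z [r′_μ, u′_ν, x_α, z_β exit]·(c • mmRead Lc (K3OfK X̃♮_j Lc S M W μ r′ ν u′) + cB • B μ r′ ν u′) x z (inl α)(inl β)
 = c·(−K_j²)·Σ_{r′∈box Lc} Σ'_{u′} [r′_μ, u′_ν exit]·( FF²[(dM_μ∘X̃♮_j)∘dM_ν] + FF²[(dM_ν∘X̃♮_j)∘dM_μ] − FF²[W_{μν}] )` — leaf-04's three words, leg class `Lc²`. -/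
theorem fourFace_dressedSource_inl_inl (hLc : 1 ≤ Lc) (hr : r ∈ box (d + 1) Lc) (sf sm : ℝ) (j : ℕ)
    {S M : Fin (d + 1) → Site (d + 1) → MKer (d + 1) (Fib d)}
    {W : Fin (d + 1) → Site (d + 1) → Fin (d + 1) → Site (d + 1) → MKer (d + 1) (Fib d)} {B : Tab d} (c cB : ℝ)
    (hb : ∀ (κ : Fin (d + 1)) (y : Site (d + 1)), Loc (dM (unitK sf sm (coDressKBmAt (toSite r) Lc (KInvStep (d := d) Lc j))) Lc S M κ y))
    (hW : ∀ (κ : Fin (d + 1)) (y : Site (d + 1)) (κ' : Fin (d + 1)) (y' : Site (d + 1)), Loc (W κ y κ' y'))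
    (hBff : ∀ κ u κ' u' x z (α β : Fin (d + 1)), B κ u κ' u' x z (Sum.inl α) (Sum.inl β) = 0) (μ ν α β : Fin (d + 1)) :
    ∑ r' ∈ box (d + 1) Lc, ∑' u' : Site (d + 1), ∑' x : Site (d + 1), ∑' z : Site (d + 1),
        (if toSite r' μ % (Lc : ℤ) = (Lc : ℤ) - 1 ∧ u' ν % (Lc : ℤ) = (Lc : ℤ) - 1 ∧ x α % (Lc : ℤ) = (Lc : ℤ) - 1 ∧ z β % (Lc : ℤ) = (Lc : ℤ) - 1 then
          (c • mmRead Lc (K3OfK (unitK sf sm (coDressKBmAt (toSite r) Lc (KInvStep (d := d) Lc j))) Lc S M W μ (toSite r') ν u') + cB • B μ (toSite r') ν u') x z (Sum.inl α) (Sum.inl β) else 0) =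
      c * -(((sf * sm) * (stepScale d Lc j * (Lc : ℝ) ^ (d + 1))⁻¹) * ((sf * sm) * (stepScale d Lc j * (Lc : ℝ) ^ (d + 1))⁻¹)) * ∑ r' ∈ box (d + 1) Lc, ∑' u' : Site (d + 1),
        (if toSite r' μ % (Lc : ℤ) = (Lc : ℤ) - 1 ∧ u' ν % (Lc : ℤ) = (Lc : ℤ) - 1 then
          ((∑' yw : Site (d + 1) × Site (d + 1),
              (if yw.1 α % ((Lc : ℤ) * (Lc : ℤ)) = (Lc : ℤ) * (Lc : ℤ) - 1 then (1 : ℝ) else 0) * (if yw.2 β % ((Lc : ℤ) * (Lc : ℤ)) = (Lc : ℤ) * (Lc : ℤ) - 1 then (1 : ℝ) else 0) *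
                comp (comp (dM (unitK sf sm (coDressKBmAt (toSite r) Lc (KInvStep (d := d) Lc j))) Lc S M μ (toSite r')) (unitK sf sm (coDressKBmAt (toSite r) Lc (KInvStep (d := d) Lc j)))) (dM (unitK sf sm (coDressKBmAt (toSite r) Lc (KInvStep (d := d) Lc j))) Lc S M ν u') yw.1 yw.2 (Sum.inl α) (Sum.inl β)) +
          (∑' yw : Site (d + 1) × Site (d + 1),
              (if yw.1 α % ((Lc : ℤ) * (Lc : ℤ)) = (Lc : ℤ) * (Lc : ℤ) - 1 then (1 : ℝ) else 0) * (if yw.2 β % ((Lc : ℤ) * (Lc : ℤ)) = (Lc : ℤ) * (Lc : ℤ) - 1 then (1 : ℝ) else 0) *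
                comp (comp (dM (unitK sf sm (coDressKBmAt (toSite r) Lc (KInvStep (d := d) Lc j))) Lc S M ν u') (unitK sf sm (coDressKBmAt (toSite r) Lc (KInvStep (d := d) Lc j)))) (dM (unitK sf sm (coDressKBmAt (toSite r) Lc (KInvStep (d := d) Lc j))) Lc S M μ (toSite r')) yw.1 yw.2 (Sum.inl α) (Sum.inl β)) -
          (∑' yw : Site (d + 1) × Site (d + 1),
              (if yw.1 α % ((Lc : ℤ) * (Lc : ℤ)) = (Lc : ℤ) * (Lc : ℤ) - 1 then (1 : ℝ) else 0) * (if yw.2 β % ((Lc : ℤ) * (Lc : ℤ)) = (Lc : ℤ) * (Lc : ℤ) - 1 then (1 : ℝ) else 0) *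
                W μ (toSite r') ν u' yw.1 yw.2 (Sum.inl α) (Sum.inl β)))
        else 0) := by
  classical
  have hχ : ∀ s : ℤ, |(fun s : ℤ => if s % (Lc : ℤ) = (Lc : ℤ) - 1 then (1 : ℝ) else 0) s| ≤ 1 := by
    intro s; simp only; split_ifs <;> simp
  rw [Finset.mul_sum]
  refine Finset.sum_congr rfl fun r' _ => ?_
  rw [← tsum_mul_left]
  refine tsum_congr fun u' => ?_
  by_cases hA : toSite r' μ % (Lc : ℤ) = (Lc : ℤ) - 1
  · by_cases hB : u' ν % (Lc : ℤ) = (Lc : ℤ) - 1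
    · simp only [hA, hB, true_and, if_true]
      have h := hasSum_mmRead_K3OfK_dressedStep_weight (d := d) hLc hr sf sm j (hb μ (toSite r')) (hb ν u') (hW μ (toSite r') ν u') α β
        (fun s : ℤ => if s % (Lc : ℤ) = (Lc : ℤ) - 1 then (1 : ℝ) else 0) (fun s : ℤ => if s % (Lc : ℤ) = (Lc : ℤ) - 1 then (1 : ℝ) else 0) hχ hχ
      have hpt : ∀ x z : Site (d + 1), (if x α % (Lc : ℤ) = (Lc : ℤ) - 1 ∧ z β % (Lc : ℤ) = (Lc : ℤ) - 1 then
            (c • mmRead Lc (K3OfK (unitK sf sm (coDressKBmAt (toSite r) Lc (KInvStep (d := d) Lc j))) Lc S M W μ (toSite r') ν u') + cB • B μ (toSite r') ν u') x z (Sum.inl α) (Sum.inl β) else 0) =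
          c * ((fun s : ℤ => if s % (Lc : ℤ) = (Lc : ℤ) - 1 then (1 : ℝ) else 0) (x α) * (fun s : ℤ => if s % (Lc : ℤ) = (Lc : ℤ) - 1 then (1 : ℝ) else 0) (z β) *
            mmRead Lc (K3OfK (unitK sf sm (coDressKBmAt (toSite r) Lc (KInvStep (d := d) Lc j))) Lc S M W μ (toSite r') ν u') x z (Sum.inl α) (Sum.inl β)) := by
        intro x z
        rw [ite_and_and_eq]
        simp only [Pi.add_apply, Pi.smul_apply, smul_eq_mul, hBff, mul_zero, add_zero]
        ring
      simp only [hpt, tsum_mul_left]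
      rw [← h.summable.tsum_prod, h.tsum_eq, readout_eq_deepFF, readout_eq_deepFF, readout_eq_deepFF]
      ring
    · simp [hA, hB]
  · simp [hA]

end Summit.QuantumFields.BalabanUV.Beta.GAN24.FourFaceSourceWords

end
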